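import Literature.Computability.Complexity.WorstCaseToMild
import Literature.Computability.Complexity.MajorityEnumeration
import HarnessLib

/-!
# Bit-string arithmetic for `𝔽₂[X]` and `GF(2^{M+1})`, and the extension `P(z)` as string computations

The VALUE LEVEL of the machine deciding the mildly hard language of `MildHardLanguage.lean`
(`HardLangMachine.lean`): every loop the machine runs, written as a `List.foldl` over `List.range` on
bit strings and proved correct against Mathlib's `Polynomial (ZMod 2)`, the field
`GF2 M = 𝔽₂[X]/(f_M)` of `InformationTheory/Coding/BCHExplicit.lean`, and the low-degree extension of
`WorstCaseToMild.lean` / `MetaComplexity/SubcubeExtension.lean`.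

* polynomials as coefficient lists: `polyOfBits`, `xorStr` (addition), `clmul` (carry-less product),
  `reduceTop`/`pmodStr` (remainder modulo a monic polynomial by Horner's rule, `polyOfBits_pmodStr` via
  `Polynomial.div_modByMonic_unique`), `polyOfBits_natBits` (numerals are bitmask polynomials
  `bitsPoly`);
* field elements as `M + 1` bits: `bits M u` (power-basis coordinates, `polyOfBits_bits_mk`: the class
  of `p` spells `p mod f_M`), the modulus string `modStr M` (`= natBits (M+2) (canonIrredBits M)`),
  `xorStr_bits`, `fmulStr`/`fmulStr_bits`, `fpowStr`, `finvStr`/`finvStr_bits` (`u⁻¹ = u^{2^{M+1}-2}`);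
* the modulus search: `dvdTestB`/`dvdTestB_iff`, the half-range test `irredTestB`/`irredTestB_iff`
  (`BCHExplicit.irreducible_bitsPoly_iff`) and the full-range test `irredFull`/`irredFull_iff` (trial
  division by every bitmask in `[2, 2^{M+1})`, `Polynomial.Monic.irreducible_iff_natDegree`),
  `modSearch`/`modSearch_eq` (the first hit is `canonIrredBits M`, by its minimality);
* evaluating the extension: `bitsOf`, `cubeStrN`/`cubeStrN_eq` (cube points), `eval_cubeBasis`,
  `deltaStr`/`deltaStr_eq` (the Lagrange indicator `δ_c(t)` as a product over the other cube points),
  `blockVal`, `rows_bitsOf`, `termStr`/`termStr_eq` (`∏_i δ_{a_i}(z_i)`), `extStr`/`extStr_eq`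
  (`Σ_a [f a] ∏_i δ_{a_i}(z_i) = ext f z`), with the range ↔ cube bijections `prod_range_bitsOf`,
  `sum_range_rows_bitsOf`.

## References

* R. J. McEliece, *The Theory of Information and Coding*, 2nd ed., CUP 2002, Ch. 9 §9.1 (binary
  polynomial arithmetic, field elements as coefficient vectors) [Mceliece2002].
* S. Arora, B. Barak, *Computational Complexity: A Modern Approach*, CUP 2009, §19.4.2 (the extension
  is computable in time polynomial in the table size: "`E` is closed under such encodings")
  [AroraBarakCC2009].
-/

noncomputable section

namespace Literature.Computability.Complexity

open Polynomial Literature.InformationTheory.Coding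

namespace GF2Str

/-! ### Coefficient lists -/

/-- The polynomial with coefficient list `l` (entry `i` is the coefficient of `X^i`). [folklore] -/
def polyOfBits : List Bool → (ZMod 2)[X]
  | [] => 0
  | b :: l => C (bitZ b) + X * polyOfBits l

/-- `polyOfBits [] = 0`. [folklore] -/
@[simp] theorem polyOfBits_nil : polyOfBits [] = 0 := rfl

/-- `polyOfBits (b :: l) = b + X · polyOfBits l`. [folklore] -/
@[simp] theorem polyOfBits_cons (b : Bool) (l : List Bool) : polyOfBits (b :: l) = C (bitZ b) + X * polyOfBits l := rfl

/-- Coefficients of `polyOfBits`. [folklore] -/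
theorem coeff_polyOfBits : ∀ (l : List Bool) (i : ℕ), (polyOfBits l).coeff i = bitZ (l.getD i false)
  | [], i => by simp
  | b :: l, 0 => by simp
  | b :: l, i + 1 => by
    rw [polyOfBits_cons, coeff_add, coeff_C_succ, coeff_X_mul, coeff_polyOfBits l i, zero_add]
    rfl

/-- The degree of `polyOfBits l` is `< |l|`. [folklore] -/
theorem degree_polyOfBits_lt (l : List Bool) : (polyOfBits l).degree < l.length := by
  rw [Polynomial.degree_lt_iff_coeff_zero]
  intro i hi
  rw [coeff_polyOfBits, List.getD_eq_default _ _ (by exact_mod_cast hi)]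
  rfl

/-- The all-zero list is `0`. [folklore] -/
@[simp] theorem polyOfBits_replicate (n : ℕ) : polyOfBits (List.replicate n false) = 0 := by
  induction n with
  | zero => rfl
  | succ n ih => rw [List.replicate_succ, polyOfBits_cons, ih]; simp

/-- Appending zeros does not change the polynomial. [folklore] -/
theorem polyOfBits_append_replicate (l : List Bool) (n : ℕ) :
    polyOfBits (l ++ List.replicate n false) = polyOfBits l := by
  induction l with
  | nil => simp
  | cons b l ih => rw [List.cons_append, polyOfBits_cons, polyOfBits_cons, ih]

/-- Two lists of the same length with the same polynomial are equal. [folklore] -/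
theorem eq_of_polyOfBits_eq {l l' : List Bool} (hlen : l.length = l'.length) (h : polyOfBits l = polyOfBits l') : l = l' := by
  apply List.ext_getElem hlen
  intro i h1 h2
  have := congrArg (fun q => q.coeff i) h
  simp only [coeff_polyOfBits] at this
  have := congrArg zBit this
  rw [zBit_bitZ, zBit_bitZ, List.getD_eq_getElem _ _ h1, List.getD_eq_getElem _ _ h2] at this
  exact this

/-! ### Addition: bitwise xor -/

/-- Bitwise xor, keeping the longer tail. [folklore] -/
def xorStr : List Bool → List Bool → List Bool
  | [], l => l
  | l, [] => l
  | a :: l, b :: l' => xor a b :: xorStr l l'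

/-- `xorStr [] l = l`. [folklore] -/
@[simp] theorem xorStr_nil_left (l : List Bool) : xorStr [] l = l := by cases l <;> rfl
/-- `xorStr l [] = l`. [folklore] -/
@[simp] theorem xorStr_nil_right (l : List Bool) : xorStr l [] = l := by cases l <;> rfl
/-- `xorStr` on conses. [folklore] -/
@[simp] theorem xorStr_cons (a b : Bool) (l l' : List Bool) : xorStr (a :: l) (b :: l') = xor a b :: xorStr l l' := rfl

/-- **Xor is addition.** [folklore] -/
theorem polyOfBits_xorStr : ∀ l l' : List Bool, polyOfBits (xorStr l l') = polyOfBits l + polyOfBits l'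
  | [], l' => by simp
  | a :: l, [] => by simp
  | a :: l, b :: l' => by
    rw [xorStr_cons, polyOfBits_cons, polyOfBits_cons, polyOfBits_cons, polyOfBits_xorStr l l', bitZ_xor, C_add]
    ring

/-- Length of `xorStr`: the maximum. [folklore] -/
theorem length_xorStr : ∀ l l' : List Bool, (xorStr l l').length = max l.length l'.length
  | [], l' => by simp
  | a :: l, [] => by simp
  | a :: l, b :: l' => by rw [xorStr_cons, List.length_cons, length_xorStr l l']; simp [Nat.succ_max_succ]

/-- `xorStr` commutes with `drop`. [folklore] -/
theorem xorStr_drop : ∀ (l l' : List Bool) (n : ℕ), (xorStr l l').drop n = xorStr (l.drop n) (l'.drop n)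
  | [], l', n => by simp
  | a :: l, [], n => by simp
  | a :: l, b :: l', 0 => by simp
  | a :: l, b :: l', n + 1 => by rw [xorStr_cons, List.drop_succ_cons, List.drop_succ_cons, List.drop_succ_cons, xorStr_drop]

/-- `xorStr` commutes with `take`. [folklore] -/
theorem xorStr_take : ∀ (l l' : List Bool) (n : ℕ), (xorStr l l').take n = xorStr (l.take n) (l'.take n)
  | [], l', n => by simp
  | a :: l, [], n => by simp
  | a :: l, b :: l', 0 => by simp
  | a :: l, b :: l', n + 1 => by rw [xorStr_cons, List.take_succ_cons, List.take_succ_cons, List.take_succ_cons, xorStr_take, xorStr_cons]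

/-! ### Multiplication: carry-less product -/

/-- **Carry-less multiplication** (the schoolbook product in `𝔽₂[X]`): shift-and-xor over the bits
of the first operand. [folklore] -/
def clmul : List Bool → List Bool → List Bool
  | [], _ => []
  | a :: l, l' => xorStr (if a then l' else []) (false :: clmul l l')

/-- **The carry-less product is the product.** [folklore] -/
theorem polyOfBits_clmul : ∀ l l' : List Bool, polyOfBits (clmul l l') = polyOfBits l * polyOfBits l'
  | [], l' => by simp [clmul]
  | a :: l, l' => by
    rw [clmul, polyOfBits_xorStr, polyOfBits_cons, polyOfBits_clmul l l', polyOfBits_cons]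
    cases a <;> simp <;> ring

/-- Length of the carry-less product: `≤ |l| + |l'|`. [folklore] -/
theorem length_clmul_le : ∀ l l' : List Bool, (clmul l l').length ≤ l.length + l'.length
  | [], l' => by simp [clmul]
  | a :: l, l' => by
    rw [clmul, length_xorStr, List.length_cons, List.length_cons]
    have := length_clmul_le l l'
    cases a <;> simp <;> omega

/-! ### Remainder modulo a monic polynomial -/

/-- One reduction step on a list of length `m + 1` by a monic modulus string `f` of length `m + 1`:
clear the top coefficient. [folklore] -/
def reduceTop (m : ℕ) (l f : List Bool) : List Bool :=
  if l.getD m false then (xorStr l f).take m else l.take m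

/-- **Remainder by Horner's rule**: `a₀ + X·a' ↦ reduceTop (a₀ :: (a' mod f))`. [folklore] -/
def pmodStr (m : ℕ) (f : List Bool) : List Bool → List Bool
  | [] => List.replicate m false
  | a :: l => reduceTop m (a :: pmodStr m f l) f

/-- `pmodStr` returns `m` bits. [folklore] -/
theorem length_pmodStr (m : ℕ) (f : List Bool) (hf : f.length = m + 1) : ∀ l, (pmodStr m f l).length = m
  | [] => by simp [pmodStr]
  | a :: l => by
    rw [pmodStr, reduceTop]
    have := length_pmodStr m f hf l
    split_ifs
    · rw [List.length_take, length_xorStr, List.length_cons, this, hf]; simp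
    · rw [List.length_take, List.length_cons, this]; simp

/-- Taking the first `m` entries of a list of length `m + 1` whose entry `m` is `0` keeps the polynomial. [folklore] -/
theorem polyOfBits_take_of_top_false {m : ℕ} {l : List Bool} (hl : l.length = m + 1) (htop : l.getD m false = false) :
    polyOfBits (l.take m) = polyOfBits l := by
  have hm : m < l.length := by omega
  have hdrop : l.drop m = [false] := by
    rw [List.drop_eq_getElem_cons hm, List.drop_eq_nil_of_le (by omega)]
    rw [List.getD_eq_getElem _ _ hm] at htop
    rw [htop]
  conv_rhs => rw [← List.take_append_drop m l, hdrop]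
  rw [show [false] = List.replicate 1 false from rfl, polyOfBits_append_replicate]

/-- **The remainder is the remainder** (`f` monic of degree `m`, given by `m + 1` bits with top bit `1`). [folklore] -/
theorem polyOfBits_pmodStr (m : ℕ) (f : List Bool) (hf : f.length = m + 1) (htop : f.getD m false = true) :
    ∀ l, polyOfBits (pmodStr m f l) = polyOfBits l %ₘ polyOfBits f := by
  -- the modulus is monic of degree `m`
  have hdeg : (polyOfBits f).degree = m := by
    apply le_antisymm
    · have := degree_polyOfBits_lt f; rw [hf] at this
      exact Order.le_of_lt_succ (by exact_mod_cast this)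
    · apply Polynomial.le_degree_of_ne_zero
      rw [coeff_polyOfBits, htop]; exact one_ne_zero
  have hmonic : (polyOfBits f).Monic := by
    rw [Monic, leadingCoeff, natDegree_eq_of_degree_eq_some hdeg, coeff_polyOfBits, htop]; rfl
  -- uniqueness of the remainder
  have key : ∀ (p r : (ZMod 2)[X]), r.degree < m → (∃ q, p = polyOfBits f * q + r) → r = p %ₘ polyOfBits f := by
    rintro p r hr ⟨q, hq⟩
    have := div_modByMonic_unique (f := p) q r hmonic ⟨by rw [hq]; ring, by rwa [hdeg]⟩
    exact this.2.symm
  intro l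
  induction l with
  | nil =>
    rw [pmodStr, polyOfBits_replicate, polyOfBits_nil, zero_modByMonic]
  | cons a l ih =>
    rw [pmodStr]
    have hlen : (a :: pmodStr m f l).length = m + 1 := by rw [List.length_cons, length_pmodStr m f hf]
    have hcons : polyOfBits (a :: pmodStr m f l) = C (bitZ a) + X * (polyOfBits l %ₘ polyOfBits f) := by
      rw [polyOfBits_cons, ih]
    -- `a + X (l mod f) ≡ a + X l (mod f)`
    have hequiv : ∃ q, C (bitZ a) + X * (polyOfBits l %ₘ polyOfBits f) = polyOfBits f * q + polyOfBits (a :: l) := by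
      refine ⟨-(X * (polyOfBits l /ₘ polyOfBits f)), ?_⟩
      have := modByMonic_add_div (polyOfBits l) (polyOfBits f)
      rw [polyOfBits_cons]
      linear_combination (X : (ZMod 2)[X]) * this
    apply key
    · -- degree of the reduced list
      have := degree_polyOfBits_lt (reduceTop m (a :: pmodStr m f l) f)
      have hl2 : (reduceTop m (a :: pmodStr m f l) f).length = m := by
        have := length_pmodStr m f hf (a :: l); rwa [pmodStr] at this
      rwa [hl2] at this
    · rw [reduceTop]
      split_ifs with h
      · -- subtract `f`
        obtain ⟨q, hq⟩ := hequiv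
        refine ⟨-(q + 1), ?_⟩
        have hl3 : (xorStr (a :: pmodStr m f l) f).length = m + 1 := by rw [length_xorStr, hlen, hf, max_self]
        have htop' : (xorStr (a :: pmodStr m f l) f).getD m false = false := by
          have e : ∀ i, (xorStr (a :: pmodStr m f l) f).getD i false =
              xor ((a :: pmodStr m f l).getD i false) (f.getD i false) := by
            intro i
            have := congrArg (fun p => zBit (p.coeff i)) (polyOfBits_xorStr (a :: pmodStr m f l) f)
            simp only [coeff_add, coeff_polyOfBits, zBit_bitZ, zBit_add] at this
            exact this
          rw [e, h, htop]; rfl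
        rw [polyOfBits_take_of_top_false hl3 htop', polyOfBits_xorStr, hcons, hq]
        ring
      · obtain ⟨q, hq⟩ := hequiv
        refine ⟨-q, ?_⟩
        have h' : (a :: pmodStr m f l).getD m false = false := by
          cases hh : (a :: pmodStr m f l).getD m false
          · rfl
          · exact absurd hh h
        rw [polyOfBits_take_of_top_false hlen h', hcons, hq]
        ring

/-! ### Numerals: `natBits` and `bitsPoly` -/

/-- The entries of `natBits D n` are the bits of `n`. [folklore] -/
theorem getD_natBits : ∀ (D n i : ℕ), (natBits D n).getD i false = (decide (i < D) && n.testBit i)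
  | 0, n, i => by simp [natBits]
  | D + 1, n, 0 => by
    rw [natBits, List.getD_cons_zero, Nat.testBit_zero]
    rcases Nat.mod_two_eq_zero_or_one n with h | h <;> simp [h]
  | D + 1, n, i + 1 => by
    rw [natBits, List.getD_cons_succ, getD_natBits D (n / 2) i, Nat.testBit_succ]
    simp

/-- **A numeral of enough bits is the bitmask polynomial**: `polyOfBits (natBits D n) = bitsPoly n`
for `n < 2ᴰ`. [folklore] -/
theorem polyOfBits_natBits {D n : ℕ} (hn : n < 2 ^ D) : polyOfBits (natBits D n) = bitsPoly n := by
  ext i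
  rw [coeff_polyOfBits, getD_natBits, coeff_bitsPoly]
  by_cases hi : i < D
  · simp only [hi, decide_true, Bool.true_and]
    cases n.testBit i <;> simp
  · have : n.testBit i = false := Nat.testBit_lt_two_pow (lt_of_lt_of_le hn (Nat.pow_le_pow_right (by norm_num) (by omega)))
    simp [hi, this]

/-! ### Field elements as `M + 1` bits -/

variable (M : ℕ)

/-- The bits of a field element: its power-basis coordinates, listed. [folklore] -/
def bits (u : GF2 M) : List Bool := List.ofFn (encF M u)

/-- `bits` has length `M + 1`. [folklore] -/
@[simp] theorem length_bits (u : GF2 M) : (bits M u).length = M + 1 := by simp [bits]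

/-- `bits` is injective. [folklore] -/
theorem bits_injective : Function.Injective (bits M) := fun _ _ h =>
  encF_injective M (List.ofFn_injective h)

/-- **The bits of the class of `p` spell `p mod f_M`.** [cite: Mceliece2002, Ch. 9 §9.1] -/
theorem polyOfBits_bits_mk (p : (ZMod 2)[X]) :
    polyOfBits (bits M (AdjoinRoot.mk (canonIrred M) p)) = p %ₘ canonIrred M := by
  ext i
  rw [coeff_polyOfBits]
  by_cases hi : i < M + 1
  · rw [bits, List.getD_eq_getElem _ _ (by simpa using hi), List.getElem_ofFn]
    simp only [encF, GF2.basis_repr_mk, bitZ_zBit]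
  · rw [List.getD_eq_default _ _ (by simpa using hi)]
    have hdeg : (p %ₘ canonIrred M).degree < (M + 1 : ℕ) := by
      have := degree_modByMonic_lt p (monic_canonIrred M)
      rwa [degree_eq_natDegree (monic_canonIrred M).ne_zero, natDegree_canonIrred] at this
    rw [coeff_eq_zero_of_degree_lt (lt_of_lt_of_le hdeg (by exact_mod_cast not_lt.1 hi))]
    rfl

/-- The bits of `u` spell a representative of `u`. [folklore] -/
theorem mk_polyOfBits_bits (u : GF2 M) : AdjoinRoot.mk (canonIrred M) (polyOfBits (bits M u)) = u := by
  obtain ⟨p, rfl⟩ := AdjoinRoot.mk_surjective u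
  rw [polyOfBits_bits_mk, AdjoinRoot.mk_eq_mk]
  have := modByMonic_add_div p (canonIrred M)
  exact ⟨-(p /ₘ canonIrred M), by linear_combination this⟩

/-- The bits spell the CANONICAL representative: `polyOfBits (bits u) %ₘ f_M = polyOfBits (bits u)`. [folklore] -/
theorem polyOfBits_bits (u : GF2 M) :
    polyOfBits (bits M u) = polyOfBits (bits M u) %ₘ canonIrred M := by
  conv_lhs => rw [← mk_polyOfBits_bits M u, polyOfBits_bits_mk]

/-- **Bits are determined by any representative**: if `mk p = u` then `bits u` spells `p mod f_M`. [folklore] -/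
theorem bits_eq_of_mk_eq {u : GF2 M} {p : (ZMod 2)[X]} (h : AdjoinRoot.mk (canonIrred M) p = u) {l : List Bool}
    (hl : l.length = M + 1) (hp : polyOfBits l = p %ₘ canonIrred M) : bits M u = l := by
  subst h
  exact eq_of_polyOfBits_eq (by rw [length_bits, hl]) (by rw [polyOfBits_bits_mk, hp])

/-! ### The modulus string and field operations on bits -/

/-- The `M + 2` bits of the modulus `f_M` (bitmask `canonIrredBits M ∈ [2^{M+1}, 2^{M+2})`). [folklore] -/
def modStr : List Bool := natBits (M + 2) (canonIrredBits M)

/-- The modulus string spells `f_M`. [folklore] -/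
theorem polyOfBits_modStr : polyOfBits (modStr M) = canonIrred M :=
  polyOfBits_natBits (canonIrredBits_spec M).2.1

/-- The modulus string has `M + 2` bits, the top one set. [folklore] -/
theorem modStr_top : (modStr M).length = M + 1 + 1 ∧ (modStr M).getD (M + 1) false = true := by
  refine ⟨by simp [modStr], ?_⟩
  have := congrArg (fun q => zBit (q.coeff (M + 1))) (polyOfBits_modStr M)
  simp only [coeff_polyOfBits, zBit_bitZ] at this
  rw [this]
  have h := monic_canonIrred M
  rw [Monic, leadingCoeff, natDegree_canonIrred] at h
  rw [h]; rfl

/-- **Field addition on bits.** [folklore] -/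
theorem xorStr_bits (u v : GF2 M) : xorStr (bits M u) (bits M v) = bits M (u + v) := by
  symm
  refine bits_eq_of_mk_eq M (p := polyOfBits (bits M u) + polyOfBits (bits M v)) ?_ ?_ ?_
  · rw [map_add, mk_polyOfBits_bits, mk_polyOfBits_bits]
  · rw [length_xorStr, length_bits, length_bits, max_self]
  · rw [polyOfBits_xorStr, add_modByMonic, ← polyOfBits_bits, ← polyOfBits_bits]

/-- **Field multiplication on bits**: carry-less product, then remainder modulo `f_M`. [folklore] -/
def fmulStr (a b : List Bool) : List Bool := pmodStr (M + 1) (modStr M) (clmul a b)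

/-- `fmulStr` multiplies. [cite: Mceliece2002, Ch. 9 §9.1] -/
theorem fmulStr_bits (u v : GF2 M) : fmulStr M (bits M u) (bits M v) = bits M (u * v) := by
  symm
  refine bits_eq_of_mk_eq M (p := polyOfBits (bits M u) * polyOfBits (bits M v)) ?_ ?_ ?_
  · rw [map_mul, mk_polyOfBits_bits, mk_polyOfBits_bits]
  · exact length_pmodStr _ _ (modStr_top M).1 _
  · rw [fmulStr, polyOfBits_pmodStr _ _ (modStr_top M).1 (modStr_top M).2, polyOfBits_clmul, polyOfBits_modStr]

/-- **Powers on bits** by `n`-fold multiplication (`n < 2^{M+1}` in use, polynomial in the field size). [folklore] -/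
def fpowStr (a : List Bool) : ℕ → List Bool
  | 0 => bits M 1
  | n + 1 => fmulStr M (fpowStr a n) a

/-- `fpowStr` computes powers. [folklore] -/
theorem fpowStr_bits (u : GF2 M) : ∀ n, fpowStr M (bits M u) n = bits M (u ^ n)
  | 0 => by simp [fpowStr]
  | n + 1 => by rw [fpowStr, fpowStr_bits u n, fmulStr_bits, pow_succ]

/-- **Inversion on bits**: `u⁻¹ = u^{2^{M+1} - 2}` (`u^{q-1} = 1` in `GF(q)`; also right for `u = 0`). [folklore] -/
def finvStr (a : List Bool) : List Bool := fpowStr M a (2 ^ (M + 1) - 2)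

/-- `finvStr` inverts (`M ≥ 1`; in `GF(2)` itself `0^{q-2} = 0⁰ = 1`). [folklore] -/
theorem finvStr_bits (hM : 1 ≤ M) (u : GF2 M) : finvStr M (bits M u) = bits M u⁻¹ := by
  rw [finvStr, fpowStr_bits]
  congr 1
  have hcard : Fintype.card (GF2 M) = 2 ^ (M + 1) := SelfCorrect.card_GF2 M
  have h4 : 4 ≤ 2 ^ (M + 1) :=
    calc (4 : ℕ) = 2 ^ 2 := by norm_num
      _ ≤ 2 ^ (M + 1) := Nat.pow_le_pow_right (by norm_num) (by omega)
  set q := 2 ^ (M + 1) with hq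
  rcases eq_or_ne u 0 with rfl | hu
  · rw [inv_zero]; exact zero_pow (by omega)
  · have h1 : u ^ (q - 1) = 1 := by rw [← hcard]; exact FiniteField.pow_card_sub_one_eq_one u hu
    have h2 : u ^ (q - 2) * u = 1 := by
      rw [← pow_succ, show q - 2 + 1 = q - 1 by omega, h1]
    exact eq_inv_of_mul_eq_one_left h2

/-! ### Divisibility and irreducibility tests on bitmasks -/

/-- The `⌊log₂ q⌋ + 1` bits of `q` spell `bitsPoly q`, with the top bit set when `q ≠ 0`. [folklore] -/
theorem natBits_log (q : ℕ) (hq : q ≠ 0) :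
    polyOfBits (natBits (Nat.log 2 q + 1) q) = bitsPoly q ∧ (natBits (Nat.log 2 q + 1) q).getD (Nat.log 2 q) false = true := by
  have h1 : polyOfBits (natBits (Nat.log 2 q + 1) q) = bitsPoly q := polyOfBits_natBits (Nat.lt_pow_succ_log_self one_lt_two q)
  refine ⟨h1, ?_⟩
  have h2 := congrArg (fun p => zBit (p.coeff (Nat.log 2 q))) h1
  simp only [coeff_polyOfBits, zBit_bitZ] at h2
  rw [h2]
  have h0 : bitsPoly q ≠ 0 := fun h => hq (bitsPoly_eq_zero_iff.1 h)
  have h3 : (bitsPoly q).coeff (Nat.log 2 q) = 1 := by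
    have := monic_of_ne_zero_zmod_two h0
    rw [Monic, leadingCoeff, natDegree_bitsPoly] at this
    exact this
  rw [h3]; rfl

/-- **Divisibility test**: reduce the bits of `n` modulo the bits of `q`; all-zero remainder. [folklore] -/
def dvdTestB (q n : ℕ) : Bool :=
  decide (pmodStr (Nat.log 2 q) (natBits (Nat.log 2 q + 1) q) (natBits (Nat.log 2 n + 1) n) =
    List.replicate (Nat.log 2 q) false)

/-- The divisibility test is right (`q ≠ 0`). [folklore] -/
theorem dvdTestB_iff (q n : ℕ) (hq : q ≠ 0) : dvdTestB q n = true ↔ bitsPoly q ∣ bitsPoly n := by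
  obtain ⟨hpq, htop⟩ := natBits_log q hq
  have hlen : (natBits (Nat.log 2 q + 1) q).length = Nat.log 2 q + 1 := length_natBits _ _
  have hmonic : (bitsPoly q).Monic := monic_of_ne_zero_zmod_two fun h => hq (bitsPoly_eq_zero_iff.1 h)
  have hn : polyOfBits (natBits (Nat.log 2 n + 1) n) = bitsPoly n := polyOfBits_natBits (Nat.lt_pow_succ_log_self one_lt_two n)
  have hrem := polyOfBits_pmodStr _ _ hlen htop (natBits (Nat.log 2 n + 1) n)
  rw [hpq, hn] at hrem
  unfold dvdTestB
  rw [decide_eq_true_iff, ← modByMonic_eq_zero_iff_dvd hmonic, ← hrem]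
  constructor
  · intro h; rw [h, polyOfBits_replicate]
  · intro h
    exact eq_of_polyOfBits_eq (by rw [length_pmodStr _ _ hlen, List.length_replicate]) (by rw [h, polyOfBits_replicate])

/-- **Irreducibility test by trial division** over all bitmasks `q < 2^{⌊log₂ n⌋/2 + 1}`
(`BCHExplicit.irreducible_bitsPoly_iff`). [folklore] -/
def irredTestB (n : ℕ) : Bool :=
  decide (2 ≤ n ∧ ∀ q < 2 ^ (Nat.log 2 n / 2 + 1), 2 ≤ q → 2 * Nat.log 2 q ≤ Nat.log 2 n → dvdTestB q n = false)

/-- The irreducibility test is right. [folklore] -/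
theorem irredTestB_iff (n : ℕ) : irredTestB n = true ↔ Irreducible (bitsPoly n) := by
  rw [irreducible_bitsPoly_iff, irredTestB, decide_eq_true_iff]
  refine and_congr_right fun _ => ⟨fun h q hq hlog hdvd => ?_, fun h q _ hq hlog => ?_⟩
  · have hqr : q < 2 ^ (Nat.log 2 n / 2 + 1) :=
      lt_of_lt_of_le (Nat.lt_pow_succ_log_self one_lt_two q) (Nat.pow_le_pow_right (by norm_num) (by omega))
    have h1 := h q hqr hq hlog
    have h2 := (dvdTestB_iff q n (by omega)).2 hdvd
    rw [h1] at h2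
    exact Bool.false_ne_true h2
  · cases hd : dvdTestB q n
    · rfl
    · exact absurd ((dvdTestB_iff q n (by omega)).1 hd) (h q hq hlog)

/-- **Irreducibility test over the full range of divisors**: no bitmask `q ∈ [2, 2^{M+1})` divides
(for `n` of bit-length `M + 2`, i.e. degree `M + 1`; the machine runs exactly this loop). [folklore] -/
def irredFull (n : ℕ) : Bool := decide (∀ q, 2 ≤ q → q < 2 ^ (M + 1) → dvdTestB q n = false)

/-- The full-range test is right on bitmasks of degree `M + 1`. [folklore] -/
theorem irredFull_iff {n : ℕ} (h1 : 2 ^ (M + 1) ≤ n) (h2 : n < 2 ^ (M + 2)) :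
    irredFull M n = true ↔ Irreducible (bitsPoly n) := by
  rw [irredFull, decide_eq_true_iff]
  have hlogn : Nat.log 2 n = M + 1 := Nat.log_eq_of_pow_le_of_lt_pow h1 h2
  have hdeg : (bitsPoly n).natDegree = M + 1 := by rw [natDegree_bitsPoly, hlogn]
  have hn0 : bitsPoly n ≠ 0 := fun h => by rw [bitsPoly_eq_zero_iff] at h; subst h; simp at h1
  have hmonic := monic_of_ne_zero_zmod_two hn0
  constructor
  · intro h
    rw [irreducible_bitsPoly_iff]
    refine ⟨le_trans (Nat.one_le_two_pow) h1 |> fun h' => by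
      have : 2 ≤ 2 ^ (M + 1) := by
        calc (2:ℕ) = 2 ^ 1 := by norm_num
          _ ≤ 2 ^ (M + 1) := Nat.pow_le_pow_right (by norm_num) (by omega)
      omega, fun q hq hlog hdvd => ?_⟩
    rw [hlogn] at hlog
    have hqlt : q < 2 ^ (M + 1) :=
      lt_of_lt_of_le (Nat.lt_pow_succ_log_self one_lt_two q) (Nat.pow_le_pow_right (by norm_num) (by omega))
    have := h q hq hqlt
    rw [(dvdTestB_iff q n (by omega)).2 hdvd] at this
    exact Bool.noConfusion this
  · intro hirr q hq hqlt
    cases hd : dvdTestB q n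
    · rfl
    · exfalso
      have hdvd := (dvdTestB_iff q n (by omega)).1 hd
      obtain ⟨r, hr⟩ := hdvd
      have hq0 : bitsPoly q ≠ 0 := fun h => by rw [bitsPoly_eq_zero_iff] at h; omega
      have hqm := monic_of_ne_zero_zmod_two hq0
      have hrm : r.Monic := Monic.of_mul_monic_left hqm (hr ▸ hmonic)
      have hdegq : (bitsPoly q).natDegree = Nat.log 2 q := natDegree_bitsPoly q
      have hlogq1 : 1 ≤ Nat.log 2 q := Nat.log_pos one_lt_two hq
      have hlogq2 : Nat.log 2 q < M + 1 := (Nat.log_lt_iff_lt_pow one_lt_two (by omega)).2 hqlt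
      rcases (hmonic.irreducible_iff_natDegree.1 hirr).2 (bitsPoly q) r hqm hrm hr.symm with h0 | h0
      · omega
      · have hr1 : r = 1 := by rw [← hrm.natDegree_eq_zero]; exact h0
        rw [hr1, mul_one] at hr
        have := congrArg natDegree hr
        rw [hdeg, hdegq] at this
        omega

/-- **The modulus search**: the first `n ∈ [2^{M+1}, 2^{M+2})` passing the irreducibility test,
written as `M + 2` bits (and `[]` while nothing is found). [folklore] -/
def modSearch : List Bool :=
  (List.range (2 ^ (M + 1))).foldl
    (fun acc i => if acc = [] then (if irredFull M (2 ^ (M + 1) + i) then natBits (M + 2) (2 ^ (M + 1) + i) else []) else acc) []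

/-- The search finds `canonIrredBits M`. [folklore] -/
theorem modSearch_eq : modSearch M = modStr M := by
  have hspec := canonIrredBits_spec M
  set c := canonIrredBits M with hc
  set F : List Bool → ℕ → List Bool := fun acc i =>
    if acc = [] then (if irredFull M (2 ^ (M + 1) + i) then natBits (M + 2) (2 ^ (M + 1) + i) else []) else acc with hF
  have hne : ∀ i, natBits (M + 2) i ≠ [] := fun i h => by simpa using congrArg List.length h
  have hc2 : c < 2 ^ (M + 1) + 2 ^ (M + 1) := by have := hspec.2.1; rw [pow_succ] at this; omega
  -- before the hit: the accumulator stays empty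
  have hbefore : ∀ j, j ≤ c - 2 ^ (M + 1) → (List.range j).foldl F [] = [] := by
    intro j hj
    induction j with
    | zero => rfl
    | succ j ih =>
      rw [List.range_succ, List.foldl_append, List.foldl_cons, List.foldl_nil, ih (by omega)]
      simp only [hF, if_true]
      have hlt : 2 ^ (M + 1) + j < c := by omega
      have : irredFull M (2 ^ (M + 1) + j) = false := by
        cases h : irredFull M (2 ^ (M + 1) + j)
        · rfl
        · exact absurd ((irredFull_iff M (by omega) (by rw [pow_succ]; omega)).1 h) (canonIrredBits_min M (by omega) hlt)
      rw [this]; rfl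
  -- at and after the hit
  have hafter : ∀ j, c - 2 ^ (M + 1) < j → j ≤ 2 ^ (M + 1) → (List.range j).foldl F [] = natBits (M + 2) c := by
    intro j hj hj2
    induction j with
    | zero => omega
    | succ j ih =>
      rw [List.range_succ, List.foldl_append, List.foldl_cons, List.foldl_nil]
      rcases Nat.lt_succ_iff_lt_or_eq.1 hj with h | h
      · rw [ih h (by omega)]; simp only [hF, hne, if_false]
      · rw [hbefore j (by omega)]
        simp only [hF, if_true]
        have hcj : 2 ^ (M + 1) + j = c := by omega
        rw [hcj, (irredFull_iff M hspec.1 hspec.2.1).2 hspec.2.2]; rfl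
  exact hafter _ (by omega) le_rfl

/-! ### Evaluating the extension on bits: cube points, Lagrange indicators, the sum over the cube -/

section Ext

open Finset SelfCorrect MetaComplexity

variable (η k : ℕ)

/-- `GF(2^{M+1})` has characteristic `2`. [folklore] -/
instance charP_GF2 : CharP (GF2 M) 2 :=
  charP_of_injective_algebraMap (algebraMap (ZMod 2) (GF2 M)).injective 2

/-- Subtraction is addition. [folklore] -/
theorem sub_eq_add' (a b : GF2 M) : a - b = a + b := CharTwo.sub_eq_add a b

/-- The cube point of a counter value: its `η` bits. [folklore] -/
def bitsOf (cv : ℕ) : Fin η → Bool := fun j => (natBits η cv).getD j false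

/-- Listing `bitsOf`. [folklore] -/
theorem ofFn_bitsOf (cv : ℕ) : List.ofFn (bitsOf η cv) = natBits η cv := by
  apply List.ext_getElem (by simp)
  intro i h1 h2
  rw [List.getElem_ofFn, bitsOf, List.getD_eq_getElem _ _ h2]

/-- `bitsOf` inverts `bitsToNat ∘ ofFn`. [folklore] -/
theorem bitsOf_bitsToNat (c : Fin η → Bool) : bitsOf η (bitsToNat (List.ofFn c)) = c := by
  apply List.ofFn_injective
  rw [ofFn_bitsOf]
  simpa using CoinEnum.natBits_bitsToNat (List.ofFn c)

/-- **The bits of a cube point**: the `η` bits, padded. [folklore] -/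
def cubeStrN (cv : ℕ) : List Bool := natBits η cv ++ List.replicate (M + 1 - η) false

/-- `cubeStrN` spells the cube point (`η ≤ M + 1`). [folklore] -/
theorem cubeStrN_eq (hη : η ≤ M + 1) (cv : ℕ) : cubeStrN M η cv = bits M (cubePt η M (bitsOf η cv)) := by
  rw [bits, cubePt, encF_decF]
  apply List.ext_getElem
  · simp [cubeStrN]; omega
  · intro i h1 h2
    rw [List.getElem_ofFn, padBits]
    simp only [cubeStrN]
    by_cases hi : i < η
    · rw [List.getElem_append_left (by simpa using hi), dif_pos hi, bitsOf, List.getD_eq_getElem _ _ (by simpa using hi)]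
    · rw [List.getElem_append_right (by simpa using not_lt.1 hi), dif_neg hi, List.getElem_replicate]

/-- The Lagrange indicator, evaluated, as a product. [folklore] -/
theorem eval_cubeBasis {σ F : Type*} [Field F] [Fintype σ] [DecidableEq σ] (v : σ → F) (c : σ) (t : F) :
    (cubeBasis v c).eval t = ∏ c' ∈ univ.erase c, (v c - v c')⁻¹ * (t - v c') := by
  unfold cubeBasis Lagrange.basis
  rw [eval_prod]
  refine prod_congr rfl fun c' _ => ?_
  simp [Lagrange.basisDivisor]

/-- One factor of the indicator product, on bits. [folklore] -/
def deltaFactor (cv cv' : ℕ) (t : List Bool) : List Bool :=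
  fmulStr M (finvStr M (xorStr (cubeStrN M η cv) (cubeStrN M η cv'))) (xorStr t (cubeStrN M η cv'))

/-- **The Lagrange indicator on bits**: the product over the other cube points. [folklore] -/
def deltaStr (cv : ℕ) (t : List Bool) : List Bool :=
  (List.range (2 ^ η)).foldl (fun acc cv' => fmulStr M acc (if cv' = cv then bits M 1 else deltaFactor M η cv cv' t)) (bits M 1)

/-- Products over counter values are products over the cube. [folklore] -/
theorem prod_range_bitsOf {β : Type*} [CommMonoid β] (g : (Fin η → Bool) → β) :
    ∏ cv ∈ range (2 ^ η), g (bitsOf η cv) = ∏ c, g c := by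
  refine prod_nbij' (fun cv => bitsOf η cv) (fun c => bitsToNat (List.ofFn c)) (fun _ _ => mem_univ _)
    (fun c _ => mem_range.2 (by simpa using bitsToNat_lt (List.ofFn c))) (fun cv hcv => ?_) (fun c _ => bitsOf_bitsToNat η c)
    (fun _ _ => rfl)
  rw [ofFn_bitsOf]
  exact bitsToNat_natBits (mem_range.1 hcv)

/-- `deltaStr` computes the indicator (`M ≥ 1`, `η ≤ M + 1`, `cv < 2^η`). [folklore] -/
theorem deltaStr_eq (hM : 1 ≤ M) (hη : η ≤ M + 1) {cv : ℕ} (hcv : cv < 2 ^ η) (t : GF2 M) :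
    deltaStr M η cv (bits M t) = bits M ((cubeBasis (cubePt η M) (bitsOf η cv)).eval t) := by
  set v : (Fin η → Bool) → GF2 M := cubePt η M with hv
  set g : ℕ → GF2 M := fun cv' => (v (bitsOf η cv) - v (bitsOf η cv'))⁻¹ * (t - v (bitsOf η cv')) with hg
  -- the fold computes the partial products
  have hfold : ∀ n, (List.range n).foldl
      (fun acc cv' => fmulStr M acc (if cv' = cv then bits M 1 else deltaFactor M η cv cv' (bits M t))) (bits M 1) =
      bits M (∏ cv' ∈ (range n).erase cv, g cv') := by
    intro n
    induction n with
    | zero => simp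
    | succ n ih =>
      rw [List.range_succ, List.foldl_append, List.foldl_cons, List.foldl_nil, ih]
      by_cases hn : n = cv
      · subst hn
        rw [if_pos rfl, Finset.range_add_one, erase_insert_eq_erase, fmulStr_bits, mul_one]
      · rw [if_neg hn, Finset.range_add_one, erase_insert_of_ne hn, prod_insert (by simp), mul_comm]
        rw [deltaFactor, cubeStrN_eq M η hη, cubeStrN_eq M η hη, xorStr_bits, xorStr_bits, finvStr_bits M hM, fmulStr_bits,
          fmulStr_bits, hg]
        simp only [sub_eq_add', hv]
  rw [deltaStr, hfold, eval_cubeBasis]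
  congr 1
  -- reindex the product over the cube
  have hinj : ∀ cv₁ ∈ range (2 ^ η), ∀ cv₂ ∈ range (2 ^ η), bitsOf η cv₁ = bitsOf η cv₂ → cv₁ = cv₂ := by
    intro cv₁ h₁ cv₂ h₂ h
    have := congrArg (fun c => bitsToNat (List.ofFn c)) h
    simp only [ofFn_bitsOf] at this
    rwa [bitsToNat_natBits (mem_range.1 h₁), bitsToNat_natBits (mem_range.1 h₂)] at this
  symm
  refine prod_nbij' (fun c => bitsToNat (List.ofFn c)) (fun cv' => bitsOf η cv') (fun c hc => ?_) (fun cv' hcv' => ?_)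
    (fun c _ => bitsOf_bitsToNat η c) (fun cv' hcv' => ?_) (fun c _ => by simp only [hg, bitsOf_bitsToNat])
  · rw [mem_erase] at hc ⊢
    refine ⟨fun h => hc.1 ?_, mem_range.2 (by simpa using bitsToNat_lt (List.ofFn c))⟩
    rw [← bitsOf_bitsToNat η c, h]
  · rw [mem_erase] at hcv' ⊢
    exact ⟨fun h => hcv'.1 (hinj _ hcv'.2 _ (mem_range.2 hcv) h), mem_univ _⟩
  · rw [mem_erase] at hcv'
    rw [ofFn_bitsOf]
    exact bitsToNat_natBits (mem_range.1 hcv'.2)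

/-! ### The product over the blocks and the sum over the cube -/

/-- The counter value of block `i` of a `kη`-bit counter `j`. [folklore] -/
def blockVal (j i : ℕ) : ℕ := j / 2 ^ (η * i) % 2 ^ η

/-- Bits of a quotient are shifted bits. [folklore] -/
theorem getD_natBits_div (D n s i : ℕ) (h : i + s < D) : (natBits D n).getD (i + s) false = (n / 2 ^ s).testBit i := by
  rw [getD_natBits, Nat.testBit_div_two_pow]
  simp [h]

/-- **Block `i` of the cube point of counter `j` is the cube point of `blockVal j i`.** [folklore] -/
theorem rows_bitsOf (j : ℕ) (i : Fin k) : rows k η (bitsOf (k * η) j) i = bitsOf η (blockVal η j i) := by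
  funext jj
  simp only [rows, bitsOf, blockVal, finProdFinEquiv_apply_val]
  have hpos : (jj : ℕ) + η * i < k * η := by
    have := i.isLt; have := jj.isLt
    calc (jj : ℕ) + η * i < η + η * i := by omega
      _ = η * (i + 1) := by ring
      _ ≤ η * k := Nat.mul_le_mul_left η (by omega)
      _ = k * η := mul_comm _ _
  rw [getD_natBits_div _ _ _ _ hpos, getD_natBits, Nat.testBit_mod_two_pow]
  simp [jj.isLt]

/-- **The product of the indicators over the blocks, on bits.** [folklore] -/
def termStr (j : ℕ) (zs : ℕ → List Bool) : List Bool :=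
  (List.range k).foldl (fun acc i => fmulStr M acc (deltaStr M η (blockVal η j i) (zs i))) (bits M 1)

/-- The bits of the coordinates `z_i`, by block number. [folklore] -/
def zStrs (z : Fin k → GF2 M) (i : ℕ) : List Bool := if h : i < k then bits M (z ⟨i, h⟩) else []

/-- `termStr` computes `∏_i δ_{a_i}(z_i)` for the cube point `a` of counter `j`. [folklore] -/
theorem termStr_eq (hM : 1 ≤ M) (hη : η ≤ M + 1) (z : Fin k → GF2 M) (j : ℕ) :
    termStr M η k j (zStrs M k z) =
      bits M (∏ i : Fin k, (cubeBasis (cubePt η M) (rows k η (bitsOf (k * η) j) i)).eval (z i)) := by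
  -- a `ℕ`-indexed form of the factors
  set G : ℕ → GF2 M := fun i =>
    (cubeBasis (cubePt η M) (bitsOf η (blockVal η j i))).eval (if h : i < k then z ⟨i, h⟩ else 0) with hG
  have hfold : ∀ n, n ≤ k → (List.range n).foldl
      (fun acc i => fmulStr M acc (deltaStr M η (blockVal η j i) (zStrs M k z i))) (bits M 1) =
      bits M (∏ i ∈ range n, G i) := by
    intro n hn
    induction n with
    | zero => rw [List.range_zero, List.foldl_nil, prod_range_zero]
    | succ n ih =>
      rw [List.range_succ, List.foldl_append, List.foldl_cons, List.foldl_nil, ih (Nat.le_of_succ_le hn),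
        prod_range_succ]
      have hnk : n < k := hn
      have hd := deltaStr_eq M η hM hη (cv := blockVal η j n) (by unfold blockVal; exact Nat.mod_lt _ (Nat.two_pow_pos η))
        (z ⟨n, hnk⟩)
      rw [zStrs, dif_pos hnk, hd, fmulStr_bits, hG]
      simp only [dif_pos hnk]
  rw [termStr, hfold k le_rfl, ← Fin.prod_univ_eq_prod_range]
  congr 1
  refine Fintype.prod_congr _ _ fun i => ?_
  rw [hG, rows_bitsOf]
  simp only [dif_pos i.isLt]

/-- **The sum over the cube, on bits**: xor-accumulate the terms of the cube points in `f`. [folklore] -/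
def extStr (fa : ℕ → Bool) (zs : ℕ → List Bool) : List Bool :=
  (List.range (2 ^ (k * η))).foldl (fun acc j => if fa j then xorStr acc (termStr M η k j zs) else acc)
    (List.replicate (M + 1) false)

/-- The bits of `0`. [folklore] -/
theorem bits_zero : bits M 0 = List.replicate (M + 1) false := by
  rw [bits]
  apply List.ext_getElem (by simp)
  intro i h1 h2
  rw [List.getElem_ofFn, List.getElem_replicate, encF_zero]

/-- Sums over counter values are sums over the cube `({0,1}^η)ᵏ`. [folklore] -/
theorem sum_range_rows_bitsOf {β : Type*} [AddCommMonoid β] (g : (Fin k → Fin η → Bool) → β) :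
    ∑ j ∈ range (2 ^ (k * η)), g (rows k η (bitsOf (k * η) j)) = ∑ a, g a := by
  -- `rows` is the currying equivalence; `bitsOf` enumerates `{0,1}^{kη}`
  have h1 : ∑ j ∈ range (2 ^ (k * η)), g (rows k η (bitsOf (k * η) j)) = ∑ u : Fin (k * η) → Bool, g (rows k η u) := by
    have := prod_range_bitsOf (β := Multiplicative β) (k * η) (fun u => Multiplicative.ofAdd (g (rows k η u)))
    exact this
  rw [h1]
  let e : (Fin (k * η) → Bool) ≃ (Fin k → Fin η → Bool) :=
    (Equiv.arrowCongr finProdFinEquiv.symm (Equiv.refl Bool)).trans (Equiv.curry _ _ _)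
  refine Fintype.sum_equiv e _ _ fun u => ?_
  rfl

/-- `extStr` computes the extension `P(z)` (`M ≥ 1`, `η ≤ M + 1`). [cite: AroraBarakCC2009, §19.4.2] -/
theorem extStr_eq (hM : 1 ≤ M) (hη : η ≤ M + 1) (f : (Fin k → Fin η → Bool) → Bool) (z : Fin k → GF2 M) :
    extStr M η k (fun j => f (rows k η (bitsOf (k * η) j))) (zStrs M k z) = bits M (SelfCorrect.ext f z) := by
  set T : ℕ → GF2 M := fun j => bitF M (f (rows k η (bitsOf (k * η) j))) *
    ∏ i : Fin k, (cubeBasis (cubePt η M) (rows k η (bitsOf (k * η) j) i)).eval (z i) with hT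
  have hfold : ∀ n, (List.range n).foldl
      (fun acc j => if f (rows k η (bitsOf (k * η) j)) then xorStr acc (termStr M η k j (zStrs M k z)) else acc)
      (List.replicate (M + 1) false) = bits M (∑ j ∈ range n, T j) := by
    intro n
    induction n with
    | zero => rw [List.range_zero, List.foldl_nil, sum_range_zero, bits_zero]
    | succ n ih =>
      rw [List.range_succ, List.foldl_append, List.foldl_cons, List.foldl_nil, ih, sum_range_succ]
      by_cases hf : f (rows k η (bitsOf (k * η) n)) = true
      · rw [if_pos hf, termStr_eq M η k hM hη, xorStr_bits]
        congr 2
        rw [hT]; simp only [hf, bitF, if_true, one_mul]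
      · rw [if_neg hf]
        congr 1
        rw [hT]; simp only [Bool.not_eq_true] at hf; simp [hf, bitF]
  rw [extStr, hfold, SelfCorrect.ext, lowDegExt]
  congr 1
  exact sum_range_rows_bitsOf η k (fun a => bitF M (f a) * ∏ i : Fin k, (cubeBasis (cubePt η M) (a i)).eval (z i))

end Ext

end GF2Str

end Literature.Computability.Complexity

end
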